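import Summits.Ventures.Crystal3D.Theorems.StickyWulffConstantTextureLiminfTexShadowLevelReachBornChains
import Summits.Ventures.Crystal3D.Theorems.StickyWulffConstantTextureLiminfTexShadowLevelReachBornBarlowMoving
import HarnessLib

/-!
# Chain bottoms in the clamped cell STEP INTO THE WINDOW: the born launches counted by the census carry all inner trackable balls
# (lane T, crux `TextureLiminfV5`, stmt-Ventures-23912, registered stub `stub_terraceCensus`; (β) assembly RESUME (d′) «born supply», geometric boundary half)

HONEST FRAMING. Venture `Summits/Ventures/Crystal3D` (cell `crystal3d-full`), route `route-Ventures-StickyWulffConstant`, helper `--supports` the law-v5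
crux `TextureLiminfV5` (stmt-Ventures-23912), lane T, mechanism (β).  Census-free, certificate-free; lane F's clamped-cell lemmas (`sealing_below_barlow`,
`coreBand₁_deep`, 19481-p2's `frame_of_face_receivingPlateBall`) by name; nothing about energies; F-C1 not moved.

THE POINT.  …LevelReachBornChains counts trackable balls against ALL chain bottoms; the born census (`bornMoving_barlow_endPairs`, p753363) counts only the
launches whose FIRST STEP lands in the height window `(−(R₀+1)−1, h+(R₀+1)+1)`.  In the clamped two-plate cell the two agree for INNER balls:
* `not_face_in_bottomBand` — a ball of `X` in the bottom seal band `[−(R₀+1)−2, −(R₀+1)−1)` within lateral radius `ρ−2` is a deep bottom-plate ball, so it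
  carries NO occupied face of a frame `A` whose dozen is neither of the bottom plate's two dozens (hence is not a straight mover of `A`);
* `chain_heights_ge` — therefore a backward chain of `A`-trackable balls starting at an inner ball `p` (`−(R₀+1)−1 ≤ p₂`, `√(p₀²+p₁²) + (p₂+R₀+3)/c₂ ≤ ρ−2`,
  `c = A w` rising) never drops below height `−(R₀+1)−1` (it would have to cross the band at lateral radius `≤ ρ−2`);
* **`card_trackable_inner_le_mul_card_launches`** — with `card_trackable_le_mul_card_goodBottoms` (the abstract count restricted to bottoms satisfying a
  predicate guaranteed along chains): for every finite set `R` of inner `A`-trackable balls (heights `< h+R₀+1`),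
  `#R ≤ K · #{b ∈ X : Tr b ∧ ¬Tr (b − c) ∧ −(R₀+1)−1 < (b + c)₂ < h+(R₀+1)+1}` whenever the cell's heights span `< K·c₂` —
  the right-hand count is EXACTLY the launch term `#B_win` of the bornMoving census with the canonical launch set `B = {Tr ∧ ¬Tr(· − c)}`.
So the born SUPPLY law is reduced to counting inner trackable (e.g. FULL) balls of the lamella — pure lattice geometry of the filling.
WHAT THIS IS NOT: that count (the riser/lamella geometry), any certificate; F-C1 not moved.
-/

noncomputable section

namespace Summit.Ventures.Crystal3D.Theorems

open Summit.Ventures.Crystal3D Finset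
open Literature.MathematicalPhysics.StatisticalMechanics (barlowPos barlowStacking IsHaggSeq barlowPos_mem basalMirror)
open Summit.Ventures.Crystal3D.Cruxes.TextureLiminf.TexShadow (E3 stacking)
open scoped InnerProductSpace

/-! ### The abstract count restricted to GOOD bottoms -/

section Good

variable {X : Finset E3} (Tr G : E3 → Prop) (c : E3)

/-- **Trackable balls against GOOD bottoms.**  As `card_trackable_le_mul_card_bottoms`, with the bottoms restricted to those satisfying a predicate `G`
that holds at the bottom of every backward chain from `R` (`hgood`). -/
theorem card_trackable_le_mul_card_goodBottoms [DecidablePred Tr] [DecidablePred G] (hTrX : ∀ q, Tr q → q ∈ X) (hc : 0 < c 2)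
    {lo hi : ℝ} (hXwin : ∀ q ∈ X, lo ≤ q 2 ∧ q 2 ≤ hi) (K : ℕ) (hK : hi - lo < K * c 2)
    (R : Finset E3) (hR : ∀ p ∈ R, Tr p)
    (hgood : ∀ p ∈ R, ∀ k : ℕ, (∀ j : ℕ, j ≤ k → Tr (p - (j : ℝ) • c)) → ¬ Tr (p - ((k : ℝ) + 1) • c) → G (p - (k : ℝ) • c)) :
    R.card ≤ K * (X.filter fun b => Tr b ∧ ¬ Tr (b - c) ∧ G b).card := by
  classical
  set Bot := X.filter (fun b => Tr b ∧ ¬ Tr (b - c) ∧ G b) with hBot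
  have hcover : R ⊆ Bot.biUnion fun b => (Finset.range K).image fun k : ℕ => b + (k : ℝ) • c := by
    intro p hp
    obtain ⟨k, hchain, hstop⟩ := exists_chain_bottom Tr c hTrX hc (hR p hp)
    set b : E3 := p - (k : ℝ) • c with hb
    have hTb : Tr b := hchain k le_rfl
    have hbc : b - c = p - ((k : ℝ) + 1) • c := by rw [hb, add_smul, one_smul, sub_sub]
    have hnot : ¬ Tr (b - c) := by rw [hbc]; exact hstop
    have hGb : G b := hgood p hp k hchain hstop
    have hbX : b ∈ X := hTrX b hTb
    have hpX : p ∈ X := hTrX p (hR p hp)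
    have hk2 : p 2 - b 2 = (k : ℝ) * c 2 := by
      rw [hb, PiLp.sub_apply, PiLp.smul_apply, smul_eq_mul]; ring
    have hkK : k < K := by
      have h1 := (hXwin p hpX).2
      have h2 := (hXwin b hbX).1
      have h3 : (k : ℝ) * c 2 < (K : ℝ) * c 2 := by linarith
      exact_mod_cast lt_of_mul_lt_mul_right h3 hc.le
    refine mem_biUnion.2 ⟨b, mem_filter.2 ⟨hbX, hTb, hnot, hGb⟩, mem_image.2 ⟨k, mem_range.2 hkK, ?_⟩⟩
    show b + (k : ℝ) • c = p
    rw [hb, sub_add_cancel]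
  calc R.card ≤ (Bot.biUnion fun b => (Finset.range K).image fun k : ℕ => b + (k : ℝ) • c).card := card_le_card hcover
    _ ≤ ∑ b ∈ Bot, ((Finset.range K).image fun k : ℕ => b + (k : ℝ) • c).card := card_biUnion_le
    _ ≤ ∑ _b ∈ Bot, K := sum_le_sum fun b _ => card_image_le.trans (card_range K).le
    _ = K * Bot.card := by rw [sum_const, smul_eq_mul, mul_comm]

end Good

/-- A straight mover of `A` along `A w` has an occupied `A`-face. -/
theorem face_of_moving (ver : WordVersion) {X : Finset E3} (A : E3 ≃ₗᵢ[ℝ] E3) {w q : E3}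
    (hmv : IsFull X A q ∨ (∃ m, IsTwinReading X A m q ∧ ⟪A w, m⟫_ℝ = 0) ∨ (ver = WordVersion.v2 ∧ IsNarrow X A (A w) q)) :
    ∃ a ∈ fccSlots, ∃ a' ∈ fccSlots, ∃ a'' ∈ fccSlots,
      ⟪a, a'⟫_ℝ = 1 / 2 ∧ ⟪a, a''⟫_ℝ = 1 / 2 ∧ ⟪a', a''⟫_ℝ = 1 / 2 ∧
      q + A a ∈ X ∧ q + A a' ∈ X ∧ q + A a'' ∈ X := by
  rcases hmv with hf | ⟨m, htr, -⟩ | ⟨-, hnar⟩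
  · exact face_of_isFull A hf
  · exact face_of_isTwinReading A htr
  · exact face_of_isNarrow hnar

/-! ### The clamped cell: no mover faces in the bottom seal band; chains stay in the window -/

section Cell

variable (ver : WordVersion) {σ₁ : ℤ → ℤ} (hσ₁ : IsHaggSeq σ₁) (L₁ : E3 ≃ₗᵢ[ℝ] E3) (s₁ : E3)
  (A : E3 ≃ₗᵢ[ℝ] E3)
  (hneA₁ : (A : E3 → E3) '' ↑fccSlots ≠ (L₁ : E3 → E3) '' ↑fccSlots)
  (hneA₂ : (A : E3 → E3) '' ↑fccSlots ≠ ((basalMirror.trans L₁ : E3 ≃ₗᵢ[ℝ] E3) : E3 → E3) '' ↑fccSlots)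
  {w : E3} (hw : w ∈ fccSlots) (hup : 0 < (A w) 2)
  (X P₁ : Finset E3) (R₀ ρ : ℝ) (hR₀ : 5 ≤ R₀) (hρ : R₀ + 2 ≤ ρ)
  (hX : ∀ p ∈ X, ∀ q ∈ X, p ≠ q → 1 ≤ dist p q) (hP₁X : P₁ ⊆ X)
  (hP₁ : ∀ p, p ∈ P₁ ↔ (p ∈ stacking L₁ s₁ σ₁ ∧ -(2 * R₀) ≤ p 2 ∧ p 2 ≤ -R₀ ∧ p 0 ^ 2 + p 1 ^ 2 ≤ ρ ^ 2))
include hσ₁ hneA₁ hneA₂ hw hup hR₀ hρ hX hP₁X hP₁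

omit hw hup in
/-- **No `A`-face in the bottom seal band.**  A ball of `X` at height in `[−(R₀+1)−2, −(R₀+1)−1)` within lateral radius `ρ − 2` is a deep ball of the
bottom plate; an occupied `A`-face there would make the `A`-dozen one of the plate's two dozens. -/
theorem not_face_in_bottomBand {q : E3} (hq : q ∈ X) (h1 : -(R₀ + 1) - 1 - 1 ≤ q 2) (h2 : q 2 < -(R₀ + 1) - 1)
    (h3 : q 0 ^ 2 + q 1 ^ 2 ≤ (ρ - 1 - 1) ^ 2) :
    ¬ (∃ a ∈ fccSlots, ∃ a' ∈ fccSlots, ∃ a'' ∈ fccSlots,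
        ⟪a, a'⟫_ℝ = 1 / 2 ∧ ⟪a, a''⟫_ℝ = 1 / 2 ∧ ⟪a', a''⟫_ℝ = 1 / 2 ∧
        q + A a ∈ X ∧ q + A a' ∈ X ∧ q + A a'' ∈ X) := by
  intro hface
  set W₁ : Set E3 := {x : E3 | -(2 * R₀) ≤ x 2 ∧ x 2 ≤ -R₀ ∧ x 0 ^ 2 + x 1 ^ 2 ≤ ρ ^ 2} with hW₁
  have hplate₁ : ∀ p ∈ stacking L₁ s₁ σ₁, p ∈ W₁ → p ∈ X := plate_mem_of_clamp₁ L₁ s₁ hP₁X hP₁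
  set CORE := P₁.filter (fun p => -(R₀ + 1) - 1 - 1 ≤ p 2 ∧ p 2 ≤ -(R₀ + 1) - 1 ∧
    p 0 ^ 2 + p 1 ^ 2 ≤ (ρ - 1 - 1) ^ 2) with hCORE
  have hseal := sealing_below_barlow L₁ s₁ hX hP₁X hP₁ (R₀ := R₀) (ρ := ρ) (by linarith) (by linarith)
  have hqC : q ∈ CORE := by
    by_contra hnot
    exact hseal q hq hnot h1 h2 h3
  obtain ⟨k, i, j, rfl, hW⟩ := coreBand₁_deep L₁ s₁ hP₁ hR₀ (by linarith) _ hqC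
  obtain ⟨a, ha, a', ha', a'', ha'', i1, i2, i3, e1, e2, e3⟩ := hface
  rcases frame_of_face_receivingPlateBall hσ₁ L₁ s₁ hX hplate₁ k i j hW A ha ha' ha'' i1 i2 i3 e1 e2 e3 with h' | h'
  · exact hneA₁ h'
  · exact hneA₂ h'

/-- **Backward chains of inner trackable balls stay above the window bottom.**  `Tr q` implies `q ∈ X` and `q` a straight mover of `A` along `c = A w`;
for an inner ball `p` (`−(R₀+1)−1 ≤ p₂`, `√(p₀²+p₁²) + (p₂ + (R₀+1) + 2)/c₂ ≤ ρ−2`) every ball `p − j•c`, `j ≤ k`, of a backward chain of trackable balls has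
height `≥ −(R₀+1)−1`. -/
theorem chain_heights_ge (Tr : E3 → Prop)
    (hTr : ∀ q, Tr q → q ∈ X ∧ (IsFull X A q ∨ (∃ m, IsTwinReading X A m q ∧ ⟪A w, m⟫_ℝ = 0) ∨ (ver = WordVersion.v2 ∧ IsNarrow X A (A w) q)))
    {p : E3} (hp2 : -(R₀ + 1) - 1 ≤ p 2)
    (hlat : Real.sqrt (p 0 ^ 2 + p 1 ^ 2) + (p 2 + (R₀ + 1) + 2) / (A w) 2 ≤ ρ - 1 - 1)
    {k : ℕ} (hchain : ∀ j : ℕ, j ≤ k → Tr (p - (j : ℝ) • A w)) :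
    ∀ j : ℕ, j ≤ k → -(R₀ + 1) - 1 ≤ (p - (j : ℝ) • A w) 2 := by
  have hc1 : ‖A w‖ = 1 := by rw [LinearIsometryEquiv.norm_map, norm_eq_one_of_mem_fccSlots hw]
  have hc2le : (A w) 2 ≤ 1 := by
    have := abs_sub_apply_le_dist' (A w) 0 2
    rw [PiLp.zero_apply, sub_zero, dist_zero_right, hc1] at this
    exact (abs_le.1 this).2
  intro j
  induction j with
  | zero => intro _; simpa using hp2
  | succ j ih =>
    intro hjk
    have hprev := ih (Nat.le_of_succ_le hjk)
    by_contra hlt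
    push Not at hlt
    set q : E3 := p - ((j + 1 : ℕ) : ℝ) • A w with hq
    have hTq : Tr q := hchain (j + 1) hjk
    obtain ⟨hqX, hmv⟩ := hTr q hTq
    -- heights: one step of at most `1` below a ball of height `≥ −(R₀+1)−1`
    have hq2 : q 2 = p 2 - ((j : ℝ) + 1) * (A w) 2 := by
      rw [hq, PiLp.sub_apply, PiLp.smul_apply, smul_eq_mul]; push_cast; ring
    have hprev2 : (p - (j : ℝ) • A w) 2 = p 2 - (j : ℝ) * (A w) 2 := by
      rw [PiLp.sub_apply, PiLp.smul_apply, smul_eq_mul]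
    rw [hprev2] at hprev
    have h1 : -(R₀ + 1) - 1 - 1 ≤ q 2 := by rw [hq2]; nlinarith
    have h2 : q 2 < -(R₀ + 1) - 1 := hlt
    -- lateral radius: `dist q p = j+1 ≤ (p₂ + R₀ + 3)/c₂`
    have hsteps : ((j : ℝ) + 1) * (A w) 2 ≤ p 2 + (R₀ + 1) + 2 := by rw [hq2] at h1; linarith
    have hsteps' : (j : ℝ) + 1 ≤ (p 2 + (R₀ + 1) + 2) / (A w) 2 := by rw [le_div_iff₀ hup]; exact hsteps
    have hdist : dist q p = (j : ℝ) + 1 := by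
      rw [hq, dist_eq_norm, sub_sub_cancel_left, norm_neg, norm_smul, hc1, mul_one, Real.norm_eq_abs]
      push_cast
      exact abs_of_nonneg (by positivity)
    have hlatq : Real.sqrt (q 0 ^ 2 + q 1 ^ 2) ≤ ρ - 1 - 1 := by
      have := lateral_radius_le_add_dist q p
      rw [hdist] at this
      linarith
    have h3 : q 0 ^ 2 + q 1 ^ 2 ≤ (ρ - 1 - 1) ^ 2 := lateral_sq_le_of_sqrt_le (by linarith) hlatq
    exact not_face_in_bottomBand hσ₁ L₁ s₁ A hneA₁ hneA₂ X P₁ R₀ ρ hR₀ hρ hX hP₁X hP₁ hqX h1 h2 h3 (face_of_moving ver A hmv)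

open scoped Classical in
/-- **Inner trackable balls are carried by the launches the census counts.**  In the clamped cell with heights of `X` in `[lo, hi]`, `hi − lo < K·c₂`
(`c = A w` rising, `A`-dozen neither bottom-plate dozen): for every finite set `R` of `A`-trackable balls `p` with `−(R₀+1)−1 ≤ p₂ < h + R₀ + 1` and
`√(p₀²+p₁²) + (p₂ + (R₀+1) + 2)/c₂ ≤ ρ − 2`,
`#R ≤ K · #{b ∈ X : Tr b ∧ ¬Tr (b − c) ∧ −(R₀+1)−1 < (b + c)₂ ∧ (b + c)₂ < h + (R₀+1) + 1}` — the bornMoving census's launch count for the canonical launch set. -/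
theorem card_trackable_inner_le_mul_card_launches (h : ℝ) (Tr : E3 → Prop)
    (hTr : ∀ q, Tr q → q ∈ X ∧ (IsFull X A q ∨ (∃ m, IsTwinReading X A m q ∧ ⟪A w, m⟫_ℝ = 0) ∨ (ver = WordVersion.v2 ∧ IsNarrow X A (A w) q)))
    {lo hi : ℝ} (hXwin : ∀ q ∈ X, lo ≤ q 2 ∧ q 2 ≤ hi) (K : ℕ) (hK : hi - lo < K * (A w) 2)
    (R : Finset E3) (hR : ∀ p ∈ R, Tr p)
    (hRin : ∀ p ∈ R, -(R₀ + 1) - 1 ≤ p 2 ∧ p 2 < h + R₀ + 1 ∧ Real.sqrt (p 0 ^ 2 + p 1 ^ 2) + (p 2 + (R₀ + 1) + 2) / (A w) 2 ≤ ρ - 1 - 1) :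
    R.card ≤ K * (X.filter fun b => Tr b ∧ ¬ Tr (b - A w) ∧
      (-(R₀ + 1) - 1 < (b + A w) 2 ∧ (b + A w) 2 < h + (R₀ + 1) + 1)).card := by
  have hc1 : ‖A w‖ = 1 := by rw [LinearIsometryEquiv.norm_map, norm_eq_one_of_mem_fccSlots hw]
  have hc2le : (A w) 2 ≤ 1 := by
    have := abs_sub_apply_le_dist' (A w) 0 2
    rw [PiLp.zero_apply, sub_zero, dist_zero_right, hc1] at this
    exact (abs_le.1 this).2
  refine card_trackable_le_mul_card_goodBottoms Tr (fun b => -(R₀ + 1) - 1 < (b + A w) 2 ∧ (b + A w) 2 < h + (R₀ + 1) + 1) (A w)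
    (fun q hq => (hTr q hq).1) hup hXwin K hK R hR ?_
  intro p hp k hchain _
  obtain ⟨hp2, hp2', hlat⟩ := hRin p hp
  have hge := chain_heights_ge ver hσ₁ L₁ s₁ A hneA₁ hneA₂ hw hup X P₁ R₀ ρ hR₀ hρ hX hP₁X hP₁ Tr hTr hp2 hlat hchain k le_rfl
  have e : (p - (k : ℝ) • A w + A w) 2 = (p - (k : ℝ) • A w) 2 + (A w) 2 := by rw [PiLp.add_apply]
  have e' : (p - (k : ℝ) • A w) 2 = p 2 - (k : ℝ) * (A w) 2 := by rw [PiLp.sub_apply, PiLp.smul_apply, smul_eq_mul]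
  refine ⟨by rw [e]; linarith, ?_⟩
  rw [e, e']
  have : 0 ≤ (k : ℝ) * (A w) 2 := by positivity
  linarith

end Cell

end Summit.Ventures.Crystal3D.Theorems

end
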